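import Summits.Langlands.Langlands.Theses.IrreducibilityBySelfDuality
import Literature.NumberTheory.Automorphic.CuspidalContragredientProofs

/-!
# Sketch — crux `ContragredientDatum` (stmt-Langlands-14322), crux-ideate round 1, ideator k = 1

First-lemma checks for the idea card `holds-one-liner`.

The crux is, binder for binder, the Literature named fact
`CuspidalAutomorphicRepData.exists_contragredient_satake hcpt` quantified over `n K hcpt`
(`contragredientDatum_iff_fact`, `Iff.rfl`), and that fact is DISCHARGED in tree by
`CuspidalAutomorphicRepData.exists_contragredient_satake_holds`
(`Literature/NumberTheory/Automorphic/CuspidalContragredientProofs.lean`, last of the series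
`CuspidalContragredient{Involution,Arch,Forms,Hecke,Proofs}`; the datum is `(W ∘ τ)/(W' ∘ τ)`,
`τ(g) = w₀ ᵗg⁻¹ w₀`, Satake `α ↦ α⁻¹` at the same level `K(𝔫)`).

* `contragredientDatum_of_holds` — the crux BY NAME as a term (audit: proof-of-item, closed).
* `contragredientDatum_structural` — the SAME proof against the item text restated verbatim with
  NO reference to the Theses file: this is the shape of the landing module (route kill criterion
  (e), cycle hazard: the Theorems module must import `CuspidalContragredientProofs` only, never
  `…Theses.IrreducibilityBySelfDuality`, because the gate imports the proving module back into the
  Theses file to write `ContragredientDatum_holds`).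
* the closing `example` certifies that the structural text IS the crux (definitional, no rewriting).
-/

namespace Summit.Langlands.Langlands.Cruxes.ContragredientDatum.Sketch

open Literature.NumberTheory.Automorphic

/-- Idea `holds-one-liner`, first (and last) lemma: the crux BY NAME, as a term. -/
theorem contragredientDatum_of_holds :
    Summit.Langlands.Langlands.Theses.IrreducibilityBySelfDuality.ContragredientDatum :=
  fun _n _K _ _ hcpt π => CuspidalAutomorphicRepData.exists_contragredient_satake_holds hcpt π

/-- The defeq bridge the grounders certified: crux ↔ ∀-closure of the named fact. -/
theorem contragredientDatum_iff_fact :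
    Summit.Langlands.Langlands.Theses.IrreducibilityBySelfDuality.ContragredientDatum ↔
      ∀ (n : ℕ) (K : Type) [Field K] [NumberField K] (hcpt : isCompact_glFiniteIntegralLevel n K),
        CuspidalAutomorphicRepData.exists_contragredient_satake hcpt :=
  Iff.rfl

/-- STRUCTURAL form (the landing shape): the item text of stmt-Langlands-14322 verbatim, proved
without mentioning the route namespace.  A prover copies THIS declaration into
`Summits/Langlands/Langlands/Theorems/<Name>.lean` with the single import
`Literature.NumberTheory.Automorphic.CuspidalContragredientProofs`. -/
theorem contragredientDatum_structural :
    ∀ (n : ℕ) (K : Type) [Field K] [NumberField K]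
      (hcpt : Literature.NumberTheory.Automorphic.isCompact_glFiniteIntegralLevel n K)
      (π : Literature.NumberTheory.Automorphic.CuspidalAutomorphicRepData n K hcpt),
      ∃ π' : Literature.NumberTheory.Automorphic.CuspidalAutomorphicRepData n K hcpt,
        ∀ (v : IsDedekindDomain.HeightOneSpectrum (NumberField.RingOfIntegers K)) (α : Multiset ℂ),
          π.1.HasSatakeParamAt v α → π'.1.HasSatakeParamAt v (α.map (·⁻¹)) :=
  fun _n _K _ _ hcpt => CuspidalAutomorphicRepData.exists_contragredient_satake_holds hcpt

/-- The structural text IS the crux (syntactic identity up to binder names). -/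
example : Summit.Langlands.Langlands.Theses.IrreducibilityBySelfDuality.ContragredientDatum :=
  contragredientDatum_structural

end Summit.Langlands.Langlands.Cruxes.ContragredientDatum.Sketch
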